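import Summits.Ventures.LatticeQCDFlow.Exactness.IMHColdStartPathAverage
import Summits.Ventures.LatticeQCDFlow.Scoring.ChainMeanSquareError
import HarnessLib

/-!
# The cold start, second order: the exact two-time law of flow-MCMC started at a mode of the weight

HONEST FRAMING: exact (Metropolis-corrected) sampling algorithms for lattice gauge theory;
figures of merit are autocorrelation/cost numbers at stated couplings and volumes; no
continuum-physics claim.

Venture `LatticeQCDFlow` (cell pub-lqcd), topic `Exactness`; FANOUT row 30 (lean-1, GEN-32).  NEW WORK of the
cell, general state space.  GEN-31 (`IMHModeRenewal`, `IMHColdStartBurnIn`, `IMHColdStartPathAverage`) computed the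
ONE-TIME laws of the flow-MCMC chain `K = indepMH q w` (proposal `q`, normalised weight `w = dπ/dq`, `π = w·q`)
started at a mode `x₀` of `w`: `δ_{x₀}K^t = (1 − r^t)·π + r^t·δ_{x₀}`, `r = 1 − 1/w(x₀)`, and left the JOINT
(two-time) laws open ("NOT CLAIMED: two-time laws / the mean-square error of cold-started averages").  They are
computed here, exactly, from the renewal structure alone (the chain at time `s` is frozen with probability `r^s`,
stationary otherwise) and the Markov property:

* §1 **`iterate_kop_indepMH_mode`** — the renewal on the operator side: `(K^u f)(x₀) = π f + r^u·(f(x₀) − π f)`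
  for every bounded measurable `f` (`K^u f = (kop K)^[u] f`, `Scoring/KernelTransitionOperator`).
* §2 **`integral_mul_iterate_kop_coldStart_mode`** — THE EXACT TWO-TIME LAW at the level of laws: for bounded
  measurable `f, g` and all `s, u`,
  `∫ f·(K^u g) d(δ_{x₀}K^s) = (1 − r^s)·∫ f·(K^u g) dπ + r^s·f(x₀)·(π g + r^u (g(x₀) − π g))`;
  centred form **`integral_mul_iterate_kop_coldStart_mode_of_centred`** (`π g = 0`):
  `= (1 − r^s)·∫ f·(K^u g) dπ + r^{s+u}·f(x₀) g(x₀)`; and THE EXACT COVARIANCE LAW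
  **`covariance_coldStart_mode`**:
  `Cov_{x₀}(f(X_s), g(X_{s+u})) = (1 − r^s)·(Cov_π(f(X_0), g(X_u)) + r^{s+u}·(f(x₀) − π f)(g(x₀) − π g))`
  — the stationary covariance damped by the probability `1 − r^s` of having thawed by the EARLIER time, plus a
  rank-one frozen term; at `u = 0` this is GEN-31's exact variance `(1 − r^s)(Var_π f + r^s δf²)`.
* §3 **`imh_chain_twoTime_mode`** — the same ON PATH SPACE (Mathlib `Kernel.trajMeasure`, via the Scoring row's
  `chain_twoTime_initial`): `E_{x₀}[f(X_s) g(X_{s+u})] = (1 − r^s)·∫ f·(K^u g) dπ + r^s f(x₀)(π g + r^u(g(x₀) − π g))`;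
  **`imh_chain_twoTime_mode_sub_stationary`** — against the stationary chain:
  `E_{x₀}[f(X_s)g(X_{s+u})] − E_π[f(X_s)g(X_{s+u})] = r^s·(f(x₀)·E_{x₀}[g(X_u)] − E_π[f(X_0)g(X_u)])` — THE TWO-TIME
  LAW FORGETS THE COLD START AT THE EXACT RATE `r^s` IN THE EARLIER INDEX (the Scoring row's any-start certificate
  `abs_chain_twoTime_sub_autocov_le_of_doeblin` has `(1 − ε/2)^{s+u}` with a constant; here `ε = 1/w(x₀)` and the
  earlier index alone carries the exact factor); **`imh_chain_twoTime_mode_of_centred`**, **`imh_chain_covariance_mode`**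
  — the centred and covariance forms on path space.
* §4 **`imh_chain_atMode_twice`**, **`imh_chain_noReturn_mode`** — atom-free proposal (`q{x₀} = 0`):
  `P_{x₀}(X_s = x₀, X_{s+u} = x₀) = r^{s+u} = P_{x₀}(X_{s+u} = x₀)`, so `P_{x₀}(X_s ≠ x₀, X_{s+u} = x₀) = 0`: THE
  COLD-STARTED CHAIN NEVER RETURNS TO THE COLD CONFIGURATION — being at the mode at a later time means never having
  left it.

Reading (gauge files `Scaling/AutoregressiveGauge…TwoTime`): with `r = 1 − A`, `A = Z/(c^{#B}M^k)` resp.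
`Z/∏_ℓ c_{#C_ℓ}`, the autocovariance of every pair of observables of a cold-started exact gauge sampler is the
equilibrium autocovariance times `1 − (1 − A)^s` plus `(1 − (1 − A)^s)(1 − A)^{s+u} δf δg`.  NOT CLAIMED: two-time laws
from a non-modal start; three-time laws; anything about the size of `∫ f·(K^u g) dπ` itself (the tree's envelopes
`Scoring/DoeblinAutocorrelation`, `Exactness/IMHModeRateSharp` bound it by `r^u`).

No `sorry`, no new definitions, nothing cited as a fact; general measurable space with measurable singletons.
-/

noncomputable section

namespace Summit.Ventures.LatticeQCDFlow.Exactness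

open MeasureTheory ProbabilityTheory Function Finset
open scoped ENNReal
open Summit.Ventures.LatticeQCDFlow.Scoring

variable {Ω : Type*} [MeasurableSpace Ω] [MeasurableSingletonClass Ω]
variable {q : Measure Ω} [IsProbabilityMeasure q] {w : Ω → ℝ}

/-! ## §1 The renewal on the operator side -/

/-- **`(K^u f)(x₀) = (1 − r^u)·π f + r^u·f(x₀)`** at a mode `x₀` of the normalised weight, for every bounded
measurable `f` (`r = 1 − 1/w(x₀)`). [ours] -/
theorem iterate_kop_indepMH_mode [Fact (Measurable w)] (hw0 : ∀ y, 0 < w y) {x₀ : Ω}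
    (hmax : ∀ y, w y ≤ w x₀) [IsProbabilityMeasure (q.withDensity fun y => ENNReal.ofReal (w y))]
    {f : Ω → ℝ} (hf : Measurable f) {C : ℝ} (hC : ∀ x, |f x| ≤ C) (u : ℕ) :
    (kop (indepMH q w))^[u] f x₀ =
      (1 - (1 - (w x₀)⁻¹) ^ u) * ∫ x, f x ∂(q.withDensity fun y => ENNReal.ofReal (w y)) +
        (1 - (w x₀)⁻¹) ^ u * f x₀ := by
  have h := integral_iterate_kop_eq_integral_iterate_bind (indepMH q w) u hf hC (Measure.dirac x₀)
  rw [integral_dirac] at h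
  rw [h]
  exact integral_iterate_bind_indepMH_dirac_mode Fact.out hw0 hmax u (integrable_of_bounded _ hf hC)

/-- Centred observable: `(K^u g)(x₀) = r^u·g(x₀)` when `π g = 0`. [ours] -/
theorem iterate_kop_indepMH_mode_of_centred [Fact (Measurable w)] (hw0 : ∀ y, 0 < w y) {x₀ : Ω}
    (hmax : ∀ y, w y ≤ w x₀) [IsProbabilityMeasure (q.withDensity fun y => ENNReal.ofReal (w y))]
    {g : Ω → ℝ} (hg : Measurable g) {C : ℝ} (hC : ∀ x, |g x| ≤ C)
    (hg0 : ∫ x, g x ∂(q.withDensity fun y => ENNReal.ofReal (w y)) = 0) (u : ℕ) :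
    (kop (indepMH q w))^[u] g x₀ = (1 - (w x₀)⁻¹) ^ u * g x₀ := by
  rw [iterate_kop_indepMH_mode hw0 hmax hg hC u, hg0, mul_zero, zero_add]

omit [MeasurableSingletonClass Ω] in
/-- A product of two bounded measurable observables, the second moved `u` steps, is bounded measurable. [ours,
bookkeeping] -/
theorem measurable_mul_iterate_kop (κ : Kernel Ω Ω) [IsMarkovKernel κ] {f g : Ω → ℝ} (hf : Measurable f)
    {Cf : ℝ} (hCf : ∀ x, |f x| ≤ Cf) (hg : Measurable g) {Cg : ℝ} (hCg : ∀ x, |g x| ≤ Cg) (u : ℕ) :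
    Measurable (fun x => f x * (kop κ)^[u] g x) ∧ ∀ x, |f x * (kop κ)^[u] g x| ≤ Cf * Cg := by
  obtain ⟨hgm, hgb⟩ := iterate_kop_bounded_measurable κ hg hCg u
  refine ⟨hf.mul hgm, fun x => ?_⟩
  rw [abs_mul]
  exact mul_le_mul (hCf x) (hgb x) (abs_nonneg _) ((abs_nonneg _).trans (hCf x))

/-! ## §2 The exact two-time law, at the level of laws -/

/-- The one-time law of a bounded measurable observable from the mode (GEN-31, bounded form):
`∫ f d(δ_{x₀}K^s) = (1 − r^s)·π f + r^s·f(x₀)`. [ours, bookkeeping] -/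
theorem integral_coldStart_mode_of_bounded (hw : Measurable w) (hw0 : ∀ y, 0 < w y) {x₀ : Ω}
    (hmax : ∀ y, w y ≤ w x₀) [IsProbabilityMeasure (q.withDensity fun y => ENNReal.ofReal (w y))]
    {f : Ω → ℝ} (hf : Measurable f) {C : ℝ} (hC : ∀ x, |f x| ≤ C) (s : ℕ) :
    ∫ x, f x ∂((fun m : Measure Ω => m.bind (indepMH q w))^[s] (Measure.dirac x₀)) =
      (1 - (1 - (w x₀)⁻¹) ^ s) * ∫ x, f x ∂(q.withDensity fun y => ENNReal.ofReal (w y)) +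
        (1 - (w x₀)⁻¹) ^ s * f x₀ :=
  integral_iterate_bind_indepMH_dirac_mode hw hw0 hmax s (integrable_of_bounded _ hf hC)

/-- **THE EXACT TWO-TIME LAW OF THE COLD START (level of laws).**  `w` measurable (a `Fact`), positive,
normalised, maximal at `x₀`; `f, g` bounded measurable; `r = 1 − 1/w(x₀)`.  For all `s, u`:
`∫ f·(K^u g) d(δ_{x₀}K^s) = (1 − r^s)·∫ f·(K^u g) dπ + r^s·f(x₀)·((1 − r^u)·π g + r^u·g(x₀))`. [ours] -/
theorem integral_mul_iterate_kop_coldStart_mode [Fact (Measurable w)] (hw0 : ∀ y, 0 < w y) {x₀ : Ω}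
    (hmax : ∀ y, w y ≤ w x₀) [IsProbabilityMeasure (q.withDensity fun y => ENNReal.ofReal (w y))]
    {f g : Ω → ℝ} (hf : Measurable f) {Cf : ℝ} (hCf : ∀ x, |f x| ≤ Cf) (hg : Measurable g) {Cg : ℝ}
    (hCg : ∀ x, |g x| ≤ Cg) (s u : ℕ) :
    ∫ x, f x * (kop (indepMH q w))^[u] g x ∂((fun m : Measure Ω => m.bind (indepMH q w))^[s] (Measure.dirac x₀)) =
      (1 - (1 - (w x₀)⁻¹) ^ s) *
          ∫ x, f x * (kop (indepMH q w))^[u] g x ∂(q.withDensity fun y => ENNReal.ofReal (w y)) +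
        (1 - (w x₀)⁻¹) ^ s * (f x₀ *
          ((1 - (1 - (w x₀)⁻¹) ^ u) * ∫ x, g x ∂(q.withDensity fun y => ENNReal.ofReal (w y)) +
            (1 - (w x₀)⁻¹) ^ u * g x₀)) := by
  obtain ⟨hFm, hFb⟩ := measurable_mul_iterate_kop (indepMH q w) hf hCf hg hCg u
  rw [integral_coldStart_mode_of_bounded Fact.out hw0 hmax hFm hFb s, iterate_kop_indepMH_mode hw0 hmax hg hCg u]

/-- **Centred form**: if `π g = 0` then `∫ f·(K^u g) d(δ_{x₀}K^s) = (1 − r^s)·∫ f·(K^u g) dπ + r^{s+u}·f(x₀)g(x₀)`.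
[ours] -/
theorem integral_mul_iterate_kop_coldStart_mode_of_centred [Fact (Measurable w)] (hw0 : ∀ y, 0 < w y) {x₀ : Ω}
    (hmax : ∀ y, w y ≤ w x₀) [IsProbabilityMeasure (q.withDensity fun y => ENNReal.ofReal (w y))]
    {f g : Ω → ℝ} (hf : Measurable f) {Cf : ℝ} (hCf : ∀ x, |f x| ≤ Cf) (hg : Measurable g) {Cg : ℝ}
    (hCg : ∀ x, |g x| ≤ Cg) (hg0 : ∫ x, g x ∂(q.withDensity fun y => ENNReal.ofReal (w y)) = 0) (s u : ℕ) :
    ∫ x, f x * (kop (indepMH q w))^[u] g x ∂((fun m : Measure Ω => m.bind (indepMH q w))^[s] (Measure.dirac x₀)) =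
      (1 - (1 - (w x₀)⁻¹) ^ s) *
          ∫ x, f x * (kop (indepMH q w))^[u] g x ∂(q.withDensity fun y => ENNReal.ofReal (w y)) +
        (1 - (w x₀)⁻¹) ^ (s + u) * (f x₀ * g x₀) := by
  rw [integral_mul_iterate_kop_coldStart_mode hw0 hmax hf hCf hg hCg s u, hg0, mul_zero, zero_add, pow_add]
  ring

/-- **THE EXACT COVARIANCE LAW OF THE COLD START (level of laws).**  For bounded measurable `f, g` and all `s, u`:
`∫ f·(K^u g) d(δ_{x₀}K^s) − (∫ f dδ_{x₀}K^s)(∫ g dδ_{x₀}K^{s+u})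
  = (1 − r^s)·[(∫ f·(K^u g) dπ − π f·π g) + r^{s+u}·(f(x₀) − π f)(g(x₀) − π g)]`. [ours] -/
theorem covariance_coldStart_mode [Fact (Measurable w)] (hw0 : ∀ y, 0 < w y) {x₀ : Ω}
    (hmax : ∀ y, w y ≤ w x₀) [IsProbabilityMeasure (q.withDensity fun y => ENNReal.ofReal (w y))]
    {f g : Ω → ℝ} (hf : Measurable f) {Cf : ℝ} (hCf : ∀ x, |f x| ≤ Cf) (hg : Measurable g) {Cg : ℝ}
    (hCg : ∀ x, |g x| ≤ Cg) (s u : ℕ) :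
    ∫ x, f x * (kop (indepMH q w))^[u] g x ∂((fun m : Measure Ω => m.bind (indepMH q w))^[s] (Measure.dirac x₀)) -
        (∫ x, f x ∂((fun m : Measure Ω => m.bind (indepMH q w))^[s] (Measure.dirac x₀))) *
          (∫ x, g x ∂((fun m : Measure Ω => m.bind (indepMH q w))^[s + u] (Measure.dirac x₀))) =
      (1 - (1 - (w x₀)⁻¹) ^ s) *
        ((∫ x, f x * (kop (indepMH q w))^[u] g x ∂(q.withDensity fun y => ENNReal.ofReal (w y)) -
            (∫ x, f x ∂(q.withDensity fun y => ENNReal.ofReal (w y))) *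
              (∫ x, g x ∂(q.withDensity fun y => ENNReal.ofReal (w y)))) +
          (1 - (w x₀)⁻¹) ^ (s + u) *
            ((f x₀ - ∫ x, f x ∂(q.withDensity fun y => ENNReal.ofReal (w y))) *
              (g x₀ - ∫ x, g x ∂(q.withDensity fun y => ENNReal.ofReal (w y))))) := by
  rw [integral_mul_iterate_kop_coldStart_mode hw0 hmax hf hCf hg hCg s u,
    integral_coldStart_mode_of_bounded Fact.out hw0 hmax hf hCf s,
    integral_coldStart_mode_of_bounded Fact.out hw0 hmax hg hCg (s + u), pow_add]
  ring

/-- **Equal times (`u = 0`)**: the exact second moment `∫ f g d(δ_{x₀}K^s) = (1 − r^s)·∫ f g dπ + r^s f(x₀)g(x₀)` —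
GEN-31's exact variance in bilinear form. [ours] -/
theorem integral_mul_coldStart_mode [Fact (Measurable w)] (hw0 : ∀ y, 0 < w y) {x₀ : Ω}
    (hmax : ∀ y, w y ≤ w x₀) [IsProbabilityMeasure (q.withDensity fun y => ENNReal.ofReal (w y))]
    {f g : Ω → ℝ} (hf : Measurable f) {Cf : ℝ} (hCf : ∀ x, |f x| ≤ Cf) (hg : Measurable g) {Cg : ℝ}
    (hCg : ∀ x, |g x| ≤ Cg) (s : ℕ) :
    ∫ x, f x * g x ∂((fun m : Measure Ω => m.bind (indepMH q w))^[s] (Measure.dirac x₀)) =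
      (1 - (1 - (w x₀)⁻¹) ^ s) * ∫ x, f x * g x ∂(q.withDensity fun y => ENNReal.ofReal (w y)) +
        (1 - (w x₀)⁻¹) ^ s * (f x₀ * g x₀) := by
  have h := integral_mul_iterate_kop_coldStart_mode (q := q) hw0 hmax hf hCf hg hCg s 0
  simp only [Function.iterate_zero, id, pow_zero, sub_self, zero_mul, zero_add, one_mul] at h
  exact h

/-! ## §3 On path space -/

/-- The one-time law on path space, bounded form: `E_{x₀}[g(X_u)] = (1 − r^u)·π g + r^u·g(x₀)`. [ours, bookkeeping] -/
theorem imh_chain_expect_mode [Fact (Measurable w)] (hw0 : ∀ y, 0 < w y) {x₀ : Ω} (hmax : ∀ y, w y ≤ w x₀)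
    [IsProbabilityMeasure (q.withDensity fun y => ENNReal.ofReal (w y))]
    {g : Ω → ℝ} (hg : Measurable g) {C : ℝ} (hC : ∀ x, |g x| ≤ C) (u : ℕ) :
    ∫ x, g (x u) ∂(Kernel.trajMeasure (X := fun _ : ℕ => Ω) (Measure.dirac x₀)
        (fun n : ℕ => (indepMH q w).comap (fun h : (i : ↥(Finset.Iic n)) → Ω => h ⟨n, Finset.mem_Iic.2 le_rfl⟩)
          (measurable_pi_apply _))) =
      (1 - (1 - (w x₀)⁻¹) ^ u) * ∫ x, g x ∂(q.withDensity fun y => ENNReal.ofReal (w y)) +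
        (1 - (w x₀)⁻¹) ^ u * g x₀ := by
  rw [chain_expect_eq_integral_iterate_bind (indepMH q w) (Measure.dirac x₀) hg hC u]
  exact integral_coldStart_mode_of_bounded Fact.out hw0 hmax hg hC u

/-- **THE EXACT TWO-TIME LAW OF THE COLD START, ON PATH SPACE.**  `w` measurable (a `Fact`), positive, normalised,
maximal at `x₀`; `f, g` bounded measurable; all `s, u`:
`E_{x₀}[f(X_s) g(X_{s+u})] = (1 − r^s)·∫ f·(K^u g) dπ + r^s·f(x₀)·((1 − r^u)·π g + r^u·g(x₀))`. [ours] -/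
theorem imh_chain_twoTime_mode [Fact (Measurable w)] (hw0 : ∀ y, 0 < w y) {x₀ : Ω} (hmax : ∀ y, w y ≤ w x₀)
    [IsProbabilityMeasure (q.withDensity fun y => ENNReal.ofReal (w y))]
    {f g : Ω → ℝ} (hf : Measurable f) {Cf : ℝ} (hCf : ∀ x, |f x| ≤ Cf) (hg : Measurable g) {Cg : ℝ}
    (hCg : ∀ x, |g x| ≤ Cg) (s u : ℕ) :
    ∫ x, f (x s) * g (x (s + u)) ∂(Kernel.trajMeasure (X := fun _ : ℕ => Ω) (Measure.dirac x₀)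
        (fun n : ℕ => (indepMH q w).comap (fun h : (i : ↥(Finset.Iic n)) → Ω => h ⟨n, Finset.mem_Iic.2 le_rfl⟩)
          (measurable_pi_apply _))) =
      (1 - (1 - (w x₀)⁻¹) ^ s) *
          ∫ x, f x * (kop (indepMH q w))^[u] g x ∂(q.withDensity fun y => ENNReal.ofReal (w y)) +
        (1 - (w x₀)⁻¹) ^ s * (f x₀ *
          ((1 - (1 - (w x₀)⁻¹) ^ u) * ∫ x, g x ∂(q.withDensity fun y => ENNReal.ofReal (w y)) +
            (1 - (w x₀)⁻¹) ^ u * g x₀)) := by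
  obtain ⟨hFm, hFb⟩ := measurable_mul_iterate_kop (indepMH q w) hf hCf hg hCg u
  rw [chain_twoTime_initial (indepMH q w) (Measure.dirac x₀) s u hg hCg hf hCf, integral_dirac,
    iterate_kop_indepMH_mode hw0 hmax hFm hFb s, iterate_kop_indepMH_mode hw0 hmax hg hCg u]

/-- **Centred form on path space**: `π g = 0` ⇒ `E_{x₀}[f(X_s) g(X_{s+u})] = (1 − r^s)·∫ f·(K^u g) dπ +
r^{s+u}·f(x₀)g(x₀)`. [ours] -/
theorem imh_chain_twoTime_mode_of_centred [Fact (Measurable w)] (hw0 : ∀ y, 0 < w y) {x₀ : Ω}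
    (hmax : ∀ y, w y ≤ w x₀) [IsProbabilityMeasure (q.withDensity fun y => ENNReal.ofReal (w y))]
    {f g : Ω → ℝ} (hf : Measurable f) {Cf : ℝ} (hCf : ∀ x, |f x| ≤ Cf) (hg : Measurable g) {Cg : ℝ}
    (hCg : ∀ x, |g x| ≤ Cg) (hg0 : ∫ x, g x ∂(q.withDensity fun y => ENNReal.ofReal (w y)) = 0) (s u : ℕ) :
    ∫ x, f (x s) * g (x (s + u)) ∂(Kernel.trajMeasure (X := fun _ : ℕ => Ω) (Measure.dirac x₀)
        (fun n : ℕ => (indepMH q w).comap (fun h : (i : ↥(Finset.Iic n)) → Ω => h ⟨n, Finset.mem_Iic.2 le_rfl⟩)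
          (measurable_pi_apply _))) =
      (1 - (1 - (w x₀)⁻¹) ^ s) *
          ∫ x, f x * (kop (indepMH q w))^[u] g x ∂(q.withDensity fun y => ENNReal.ofReal (w y)) +
        (1 - (w x₀)⁻¹) ^ (s + u) * (f x₀ * g x₀) := by
  rw [imh_chain_twoTime_mode hw0 hmax hf hCf hg hCg s u, hg0, mul_zero, zero_add, pow_add]
  ring

/-- **AGAINST THE STATIONARY CHAIN: THE TWO-TIME LAW FORGETS THE COLD START AT THE EXACT RATE `r^s` IN THE EARLIER
INDEX**: `E_{x₀}[f(X_s)g(X_{s+u})] − E_π[f(X_s)g(X_{s+u})] = r^s·(f(x₀)·E_{x₀}[g(X_u)] − E_π[f(X_0)g(X_u)])`. [ours] -/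
theorem imh_chain_twoTime_mode_sub_stationary [Fact (Measurable w)] (hw0 : ∀ y, 0 < w y) {x₀ : Ω}
    (hmax : ∀ y, w y ≤ w x₀) [IsProbabilityMeasure (q.withDensity fun y => ENNReal.ofReal (w y))]
    {f g : Ω → ℝ} (hf : Measurable f) {Cf : ℝ} (hCf : ∀ x, |f x| ≤ Cf) (hg : Measurable g) {Cg : ℝ}
    (hCg : ∀ x, |g x| ≤ Cg) (s u : ℕ) :
    ∫ x, f (x s) * g (x (s + u)) ∂(Kernel.trajMeasure (X := fun _ : ℕ => Ω) (Measure.dirac x₀)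
        (fun n : ℕ => (indepMH q w).comap (fun h : (i : ↥(Finset.Iic n)) → Ω => h ⟨n, Finset.mem_Iic.2 le_rfl⟩)
          (measurable_pi_apply _))) -
      ∫ x, f (x s) * g (x (s + u)) ∂(Kernel.trajMeasure (X := fun _ : ℕ => Ω)
        (q.withDensity fun y => ENNReal.ofReal (w y))
        (fun n : ℕ => (indepMH q w).comap (fun h : (i : ↥(Finset.Iic n)) → Ω => h ⟨n, Finset.mem_Iic.2 le_rfl⟩)
          (measurable_pi_apply _))) =
      (1 - (w x₀)⁻¹) ^ s *
        (f x₀ * ∫ x, g (x u) ∂(Kernel.trajMeasure (X := fun _ : ℕ => Ω) (Measure.dirac x₀)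
            (fun n : ℕ => (indepMH q w).comap (fun h : (i : ↥(Finset.Iic n)) → Ω => h ⟨n, Finset.mem_Iic.2 le_rfl⟩)
              (measurable_pi_apply _))) -
          ∫ x, f (x 0) * g (x (0 + u)) ∂(Kernel.trajMeasure (X := fun _ : ℕ => Ω)
            (q.withDensity fun y => ENNReal.ofReal (w y))
            (fun n : ℕ => (indepMH q w).comap (fun h : (i : ↥(Finset.Iic n)) → Ω => h ⟨n, Finset.mem_Iic.2 le_rfl⟩)
              (measurable_pi_apply _)))) := by
  have hπ : Kernel.Invariant (indepMH q w) (q.withDensity fun y => ENNReal.ofReal (w y)) :=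
    indepMH_invariant (q := q) Fact.out hw0
  rw [imh_chain_twoTime_mode hw0 hmax hf hCf hg hCg s u, imh_chain_expect_mode hw0 hmax hg hCg u,
    chain_twoTime_eq_integral hπ hg hCg hf hCf s u, chain_twoTime_eq_integral hπ hg hCg hf hCf 0 u]
  ring

/-- **THE EXACT COVARIANCE LAW OF THE COLD START, ON PATH SPACE** (Mathlib's `ProbabilityTheory.covariance`):
`Cov_{x₀}[f(X_s), g(X_{s+u})] = (1 − r^s)·[(∫ f·(K^u g) dπ − π f·π g) + r^{s+u}·(f(x₀) − π f)(g(x₀) − π g)]`; the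
bracket's first term is the stationary covariance `Cov_π[f(X_0), g(X_u)]` (`Scoring/ChainTimeAverage.chain_covariance`).
[ours] -/
theorem imh_chain_covariance_mode [Fact (Measurable w)] (hw0 : ∀ y, 0 < w y) {x₀ : Ω}
    (hmax : ∀ y, w y ≤ w x₀) [IsProbabilityMeasure (q.withDensity fun y => ENNReal.ofReal (w y))]
    {f g : Ω → ℝ} (hf : Measurable f) {Cf : ℝ} (hCf : ∀ x, |f x| ≤ Cf) (hg : Measurable g) {Cg : ℝ}
    (hCg : ∀ x, |g x| ≤ Cg) (s u : ℕ) :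
    cov[fun x : ℕ → Ω => f (x s), fun x : ℕ → Ω => g (x (s + u));
        Kernel.trajMeasure (X := fun _ : ℕ => Ω) (Measure.dirac x₀)
          (fun n : ℕ => (indepMH q w).comap (fun h : (i : ↥(Finset.Iic n)) → Ω => h ⟨n, Finset.mem_Iic.2 le_rfl⟩)
            (measurable_pi_apply _))] =
      (1 - (1 - (w x₀)⁻¹) ^ s) *
        ((∫ x, f x * (kop (indepMH q w))^[u] g x ∂(q.withDensity fun y => ENNReal.ofReal (w y)) -
            (∫ x, f x ∂(q.withDensity fun y => ENNReal.ofReal (w y))) *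
              (∫ x, g x ∂(q.withDensity fun y => ENNReal.ofReal (w y)))) +
          (1 - (w x₀)⁻¹) ^ (s + u) *
            ((f x₀ - ∫ x, f x ∂(q.withDensity fun y => ENNReal.ofReal (w y))) *
              (g x₀ - ∫ x, g x ∂(q.withDensity fun y => ENNReal.ofReal (w y))))) := by
  rw [covariance_eq_sub (chain_memLp (κ := indepMH q w) (Measure.dirac x₀) hf hCf s)
    (chain_memLp (κ := indepMH q w) (Measure.dirac x₀) hg hCg (s + u))]
  simp only [Pi.mul_apply]
  rw [imh_chain_twoTime_mode hw0 hmax hf hCf hg hCg s u, imh_chain_expect_mode hw0 hmax hf hCf s,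
    imh_chain_expect_mode hw0 hmax hg hCg (s + u), pow_add]
  ring

/-! ## §4 The cold-started chain never returns to the mode -/

omit [MeasurableSingletonClass Ω] [IsProbabilityMeasure q] in
/-- With an atom-free proposal the target has no atom at `x₀` either. [ours, bookkeeping] -/
theorem target_singleton_real_eq_zero {x₀ : Ω} (hqx : q {x₀} = 0) :
    (q.withDensity fun y => ENNReal.ofReal (w y)).real {x₀} = 0 := by
  rw [Measure.real, withDensity_singleton_eq_zero hqx, ENNReal.toReal_zero]

omit [MeasurableSingletonClass Ω] [IsProbabilityMeasure q] in
/-- An integrand supported on the `π`-null point `{x₀}` integrates to zero against `π`. [ours, bookkeeping] -/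
theorem integral_indicator_singleton_mul_eq_zero {x₀ : Ω} (hqx : q {x₀} = 0) (h : Ω → ℝ) :
    ∫ x, ({x₀} : Set Ω).indicator (1 : Ω → ℝ) x * h x ∂(q.withDensity fun y => ENNReal.ofReal (w y)) = 0 := by
  refine integral_eq_zero_of_ae ?_
  have hnull : (q.withDensity fun y => ENNReal.ofReal (w y)) {x₀} = 0 := withDensity_singleton_eq_zero hqx
  filter_upwards [measure_eq_zero_iff_ae_notMem.1 hnull] with x hx
  rw [Set.indicator_of_notMem hx, zero_mul, Pi.zero_apply]

/-- **At the mode at both times**: atom-free proposal (`q{x₀} = 0`); then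
`P_{x₀}(X_s = x₀, X_{s+u} = x₀) = r^{s+u}`. [ours] -/
theorem imh_chain_atMode_twice [Fact (Measurable w)] (hw0 : ∀ y, 0 < w y) {x₀ : Ω} (hmax : ∀ y, w y ≤ w x₀)
    (hqx : q {x₀} = 0) [IsProbabilityMeasure (q.withDensity fun y => ENNReal.ofReal (w y))] (s u : ℕ) :
    ∫ x, ({x₀} : Set Ω).indicator (1 : Ω → ℝ) (x s) * ({x₀} : Set Ω).indicator (1 : Ω → ℝ) (x (s + u))
        ∂(Kernel.trajMeasure (X := fun _ : ℕ => Ω) (Measure.dirac x₀)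
          (fun n : ℕ => (indepMH q w).comap (fun h : (i : ↥(Finset.Iic n)) → Ω => h ⟨n, Finset.mem_Iic.2 le_rfl⟩)
            (measurable_pi_apply _))) = (1 - (w x₀)⁻¹) ^ (s + u) := by
  have hm : Measurable (({x₀} : Set Ω).indicator (1 : Ω → ℝ)) :=
    measurable_one.indicator (measurableSet_singleton x₀)
  have hb : ∀ x, |({x₀} : Set Ω).indicator (1 : Ω → ℝ) x| ≤ 1 := fun x => by
    by_cases hx : x ∈ ({x₀} : Set Ω)
    · rw [Set.indicator_of_mem hx, Pi.one_apply, abs_one]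
    · rw [Set.indicator_of_notMem hx, abs_zero]; exact zero_le_one
  have hπ0 : ∫ x, ({x₀} : Set Ω).indicator (1 : Ω → ℝ) x ∂(q.withDensity fun y => ENNReal.ofReal (w y)) = 0 := by
    rw [integral_indicator_one (measurableSet_singleton x₀), target_singleton_real_eq_zero hqx]
  rw [imh_chain_twoTime_mode hw0 hmax hm hb hm hb s u, integral_indicator_singleton_mul_eq_zero hqx, hπ0,
    Set.indicator_of_mem (Set.mem_singleton x₀), Pi.one_apply, pow_add]
  ring

/-- **THE COLD-STARTED CHAIN NEVER RETURNS TO THE MODE** (atom-free proposal): `P_{x₀}(X_s ≠ x₀, X_{s+u} = x₀) = 0`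
— written as `E_{x₀}[(1 − 1_{x₀}(X_s))·1_{x₀}(X_{s+u})] = 0`: being at the cold configuration at time `s + u` means
never having left it. [ours] -/
theorem imh_chain_noReturn_mode [Fact (Measurable w)] (hw0 : ∀ y, 0 < w y) {x₀ : Ω} (hmax : ∀ y, w y ≤ w x₀)
    (hqx : q {x₀} = 0) [IsProbabilityMeasure (q.withDensity fun y => ENNReal.ofReal (w y))] (s u : ℕ) :
    ∫ x, (1 - ({x₀} : Set Ω).indicator (1 : Ω → ℝ) (x s)) * ({x₀} : Set Ω).indicator (1 : Ω → ℝ) (x (s + u))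
        ∂(Kernel.trajMeasure (X := fun _ : ℕ => Ω) (Measure.dirac x₀)
          (fun n : ℕ => (indepMH q w).comap (fun h : (i : ↥(Finset.Iic n)) → Ω => h ⟨n, Finset.mem_Iic.2 le_rfl⟩)
            (measurable_pi_apply _))) = 0 := by
  set P := Kernel.trajMeasure (X := fun _ : ℕ => Ω) (Measure.dirac x₀)
      (fun n : ℕ => (indepMH q w).comap (fun h : (i : ↥(Finset.Iic n)) → Ω => h ⟨n, Finset.mem_Iic.2 le_rfl⟩)
        (measurable_pi_apply _)) with hP
  have hm : Measurable (({x₀} : Set Ω).indicator (1 : Ω → ℝ)) :=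
    measurable_one.indicator (measurableSet_singleton x₀)
  have hb : ∀ x, |({x₀} : Set Ω).indicator (1 : Ω → ℝ) x| ≤ 1 := fun x => by
    by_cases hx : x ∈ ({x₀} : Set Ω)
    · rw [Set.indicator_of_mem hx, Pi.one_apply, abs_one]
    · rw [Set.indicator_of_notMem hx, abs_zero]; exact zero_le_one
  have hπ0 : ∫ x, ({x₀} : Set Ω).indicator (1 : Ω → ℝ) x ∂(q.withDensity fun y => ENNReal.ofReal (w y)) = 0 := by
    rw [integral_indicator_one (measurableSet_singleton x₀), target_singleton_real_eq_zero hqx]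
  have h1 : Integrable (fun x : ℕ → Ω => ({x₀} : Set Ω).indicator (1 : Ω → ℝ) (x (s + u))) P :=
    integrable_of_bounded P (hm.comp (measurable_pi_apply (s + u))) fun x => hb (x (s + u))
  have h2 : Integrable (fun x : ℕ → Ω => ({x₀} : Set Ω).indicator (1 : Ω → ℝ) (x s) *
      ({x₀} : Set Ω).indicator (1 : Ω → ℝ) (x (s + u))) P :=
    integrable_of_bounded P ((hm.comp (measurable_pi_apply s)).mul (hm.comp (measurable_pi_apply (s + u))))
      (C := 1 * 1) fun x => by
        rw [abs_mul]; exact mul_le_mul (hb _) (hb _) (abs_nonneg _) zero_le_one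
  have hsplit : ∫ x, (1 - ({x₀} : Set Ω).indicator (1 : Ω → ℝ) (x s)) *
      ({x₀} : Set Ω).indicator (1 : Ω → ℝ) (x (s + u)) ∂P =
      ∫ x, ({x₀} : Set Ω).indicator (1 : Ω → ℝ) (x (s + u)) ∂P -
        ∫ x, ({x₀} : Set Ω).indicator (1 : Ω → ℝ) (x s) * ({x₀} : Set Ω).indicator (1 : Ω → ℝ) (x (s + u)) ∂P := by
    rw [← integral_sub h1 h2]
    refine integral_congr_ae (ae_of_all _ fun x => ?_)
    ring
  rw [hsplit, hP, imh_chain_atMode_twice hw0 hmax hqx s u, imh_chain_expect_mode hw0 hmax hm hb (s + u), hπ0,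
    Set.indicator_of_mem (Set.mem_singleton x₀), Pi.one_apply]
  ring

end Summit.Ventures.LatticeQCDFlow.Exactness
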